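import Literature.AlgebraicGeometry.Limits.SubalgebraDiagram
import HarnessLib

/-!
# Limits of schemes: a closed subset of `P ×_K Spec B` with quasi-compact complement comes from a stage `P ×_K Spec K[t]`; the generic parameter over a ring

Topic: `Literature/AlgebraicGeometry/Limits` (EGA IV₃ §8.3 / Görtz–Wedhorn I (10.13), Thm. 10.57:
in a limit `X = lim Xᵢ` of quasi-compact quasi-separated schemes with affine transition maps,
every quasi-compact open of `X` is the preimage of a quasi-compact open of some `Xᵢ` — Stacks
01Z4, Mathlib `exists_preimage_eq`). Sequel of `Limits/SubalgebraDiagram` (`SubalgApprox`: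
`(P ⊗ Spec B).left = lim_t (P ⊗ Spec K[t]).left` over the finite subsets `t ⊇ s₁` of a
`K`-algebra `B`, `K` ANY commutative ring). Theorems only (no definition, no named fact).

* `SubalgApprox.exists_isClosed_preimage_π_eq` — **a Zariski-closed `V ⊆ P ×_K Spec B` with
  quasi-compact complement is the preimage of a Zariski-closed subset of a stage
  `P ×_K Spec K[t]`**, `t ⊇ s₁` finite (Stacks 01Z4 applied to the complement). This is the
  relative form — base RING `K` instead of base field — of
  `HodgeTheory.exists_finset_isClosed_preimage_eq` (`AlgebraicCyclesDefinedOverQbarParameter`,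
  for `X₀ ⊗_σ L = lim X₀ ⊗_K K[s]` over a field `K`), which is what spreads a closed subset of
  ONE fibre of a family `𝒳₀ → Spec R` — the fibre `𝒳₀ ×_R Spec L` over an `L`-point of the base —
  to a closed subset of the base-changed family `𝒳₀ ×_R Spec R[t]` over the affine `R`-scheme
  `T₀ = Spec R[t]` of finite type ("we may spread out `Z` … over a variety `Y` over `k`",
  Charles–Schnell, Remark after Cor. 11.3.16; Voisin 2007 §3).
* `SubalgApprox.baseCone_π_app_apply_eq_genericPoint` — **the generic parameter**: for `B = L` a
  FIELD, the leg `Spec L → Spec K[t]` maps (the point of) `Spec L` to the GENERIC point of the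
  integral stage `Spec K[t]` (`K[t] ⊆ L` is a domain and the leg is `Spec` of the inclusion); with
  `isDominant_specMap_algebraMap_sub` — `Spec K[t] → Spec K` is dominant as soon as `K → L` is
  injective (the parameter variety DOMINATES the base).

Consumer: the spreading step (S2) of stub `GenericPropagation` of the crux line
`padic-disc-transport` (`Summits/HodgeConjecture/HodgeConjecture/Cruxes/VariationalHodge`): the
support of a class on the fibre `𝒳_s` over a complex point `s` lying over the generic point of an
affine open `Spec R ⊆ S₀` spreads to a closed subset of `𝒳₀ ×_{S₀} T₀`, `T₀ = Spec R[t] → S₀`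
dominant, whose slice at the tautological (generic) complex point of `T₀` is the given support.

## References

* [GortzWedhorn2020] U. Görtz, T. Wedhorn, Algebraic Geometry I: Schemes, 2nd ed. (2020),
  (10.13) and Thm. 10.57.
* [EGAIV3] A. Grothendieck, J. Dieudonné, EGA IV₃, Publ. Math. IHÉS 28 (1966), §8.2, Thm. 8.3.11.
* [StacksProject] The Stacks Project, Tag 01Z4.
* [CharlesSchnell2014Notes] F. Charles, C. Schnell, Notes on absolute Hodge classes (2014),
  Remark after Cor. 11.3.16; Lemma 11.3.14.
-/

noncomputable section

universe u

open CategoryTheory CategoryTheory.Limits AlgebraicGeometry TopologicalSpace Opposite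
open MonoidalCategory

namespace Literature.AlgebraicGeometry.Limits

namespace SubalgApprox

open Literature.AlgebraicGeometry.Motives

/-! ## Closed subsets with quasi-compact complement come from a stage -/

section Closed

variable {K B : Type u} [CommRing K] [CommRing B] [Algebra K B] (s₁ : Finset B)
  (P : SchemeOver K)

set_option backward.isDefEq.respectTransparency false in
/-- **A Zariski-closed subset of `P ×_K Spec B` with quasi-compact complement is pulled back from
a stage `P ×_K Spec K[t]`**, `t ⊇ s₁` a finite subset of `B`: the complement, a quasi-compact
open of the limit `(P ⊗ Spec B).left = lim_t (P ⊗ Spec K[t]).left` (`isLimitProdCone`, affine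
transition maps), is the preimage of an open of some stage (Stacks 01Z4, Mathlib
`exists_preimage_eq`); take complements. The map to the stage is the leg
`(prodCone K B s₁ P).π.app (op t) = (P ◁ (Spec K[t] ← Spec B)).left`.
[cite: StacksProject, Tag 01Z4] [cite: GortzWedhorn2020, (10.13) and Thm. 10.57] -/
theorem exists_isClosed_preimage_π_eq {V : Set ↥(P ⊗ specOver K B).left} (hV : IsClosed V)
    (hVc : IsCompact Vᶜ) :
    ∃ (t : Idx B s₁) (Z : Set ↥((prodDiagram K B s₁ P).obj (op t))), IsClosed Z ∧
      V = ((prodCone K B s₁ P).π.app (op t)).base ⁻¹' Z := by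
  let U : (prodCone K B s₁ P).pt.Opens := ⟨Vᶜ, hV.isOpen_compl⟩
  have hU : IsCompact (U : Set (prodCone K B s₁ P).pt) := hVc
  obtain ⟨i, W, -, hW⟩ :=
    exists_preimage_eq (prodDiagram K B s₁ P) (prodCone K B s₁ P) (isLimitProdCone K B s₁ P) U hU
  refine ⟨i.unop, (W : Set ((prodDiagram K B s₁ P).obj i))ᶜ, W.2.isClosed_compl, ?_⟩
  ext x
  have hx : x ∈ V ↔ x ∉ (U : Set (prodCone K B s₁ P).pt) := by
    change x ∈ V ↔ x ∉ Vᶜ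
    rw [Set.notMem_compl_iff]
  rw [hx, ← hW]
  rfl

end Closed

/-! ## The generic parameter: `Spec L → Spec K[t]` hits the generic point -/

section Generic

variable {K L : Type u} [CommRing K] [Field L] [Algebra K L] (s₁ : Finset L)

/-- For a subring `A` of a field mapped injectively into a field `L`, `Spec L → Spec A` sends
every point to the generic point (`A` a domain; the image is the kernel `(0)`). [folklore] -/
private theorem specMap_apply_eq_genericPoint' {A : Type u} [CommRing A] [IsDomain A]
    (ψ : A →+* L) (hψ : Function.Injective ψ) (p : ↥(Spec (CommRingCat.of L))) :
    (Spec.map (CommRingCat.ofHom ψ)).base p = genericPoint ↥(Spec (CommRingCat.of A)) := by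
  rw [genericPoint_eq_bot_of_affine]
  apply PrimeSpectrum.ext
  change Ideal.comap ψ p.asIdeal = ⊥
  have hp : p.asIdeal = ⊥ := Ideal.eq_bot_of_prime p.asIdeal
  rw [hp, ← RingHom.ker_eq_comap_bot]
  exact (RingHom.injective_iff_ker_eq_bot ψ).mp hψ

/-- **The generic parameter.** For a FIELD `L` over the ring `K`, the leg
`Spec L → Spec K[t]` of `baseCone` maps the point of `Spec L` to the GENERIC point of the
integral stage `Spec K[t]` (`K[t] ⊆ L` is a domain; the leg is `Spec` of the inclusion, whose
kernel is zero): the `L`-point of the parameter scheme `T₀ = Spec K[t]` defined by the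
coefficients `t` is generic — "`Z` … is therefore defined over a subfield of finite transcendence
degree", read as a point over the generic point of its model.
[cite: CharlesSchnell2014Notes, Remark after Cor. 11.3.16 and Lemma 11.3.14] -/
theorem baseCone_π_app_apply_eq_genericPoint (t : Idx L s₁)
    (p : ↥((baseCone K L s₁).pt.left)) :
    ((baseCone K L s₁).π.app (op t)).left.base p =
      genericPoint ↥(((baseDiagram K L s₁).obj (op t)).left) := by
  rw [baseCone_π_app_left]
  exact specMap_apply_eq_genericPoint' (sub K L t.1).val.toRingHom Subtype.val_injective p

/-- **The parameter scheme dominates the base**: if `K → L` is injective, `Spec K[t] → Spec K`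
is dominant (`K → K[t]` is injective, and an injective ring map has dense `Spec`-image).
[cite: GortzWedhorn2020, (10.13)] -/
theorem isDominant_baseDiagram_obj_hom (hKL : Function.Injective (algebraMap K L))
    (t : Idx L s₁) : IsDominant ((baseDiagram K L s₁).obj (op t)).hom := by
  rw [baseDiagram_obj]
  change IsDominant (Spec.map (CommRingCat.ofHom (algebraMap K (sub K L t.1))))
  refine ⟨(PrimeSpectrum.denseRange_comap_iff_ker_le_nilRadical _).2 ?_⟩
  intro x hx
  have h0 : algebraMap K (sub K L t.1) x = 0 := hx
  have h1 : algebraMap K L x = 0 := by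
    have := congrArg (fun y : sub K L t.1 => (y : L)) h0
    simpa using this
  have hx0 : x = 0 := hKL (by rw [h1, map_zero])
  rw [hx0]
  exact zero_mem _

end Generic

/-! ## The two together: spread of a closed subset over a dominating parameter scheme of finite type -/

section Spread

variable {K L : Type u} [CommRing K] [Field L] [Algebra K L] (s₁ : Finset L) (P : SchemeOver K)

/-- **Spread of a closed subset of `P ×_K Spec L` over a parameter scheme of finite type.** For a
ring `K`, a field `L` over `K`, a `K`-scheme `P` and a Zariski-closed `V ⊆ P ×_K Spec L` with
quasi-compact complement, there are a finite `t ⊆ L` (containing any prescribed `s₁`) and a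
closed `Z ⊆ P ×_K Spec K[t]` — `K[t] ⊆ L` a `K`-algebra of finite type and a domain — with
`V` the preimage of `Z` under the base change `P ×_K Spec L → P ×_K Spec K[t]` of the leg
`Spec L → Spec K[t]`, which hits the GENERIC point of `Spec K[t]`. In words: `V` is the slice,
over the generic `L`-point of the parameter scheme `T₀ = Spec K[t]`, of a closed subset of the
family `P ×_K T₀ → T₀`. [cite: CharlesSchnell2014Notes, Remark after Cor. 11.3.16]
[cite: StacksProject, Tag 01Z4] -/
theorem exists_spread_isClosed_over_generic {V : Set ↥(P ⊗ specOver K L).left} (hV : IsClosed V)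
    (hVc : IsCompact Vᶜ) :
    ∃ (t : Idx L s₁) (Z : Set ↥((prodDiagram K L s₁ P).obj (op t))), IsClosed Z ∧
      V = ((prodCone K L s₁ P).π.app (op t)).base ⁻¹' Z ∧
      Algebra.FiniteType K (sub K L t.1) ∧ IsIntegral (((baseDiagram K L s₁).obj (op t)).left) ∧
      (∀ p : ↥((baseCone K L s₁).pt.left), ((baseCone K L s₁).π.app (op t)).left.base p =
        genericPoint ↥(((baseDiagram K L s₁).obj (op t)).left)) ∧
      IsPullback ((prodCone K L s₁ P).π.app (op t)) (pullback.snd P.hom (specOver K L).hom)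
        (pullback.snd P.hom ((baseDiagram K L s₁).obj (op t)).hom)
        ((baseCone K L s₁).π.app (op t)).left := by
  obtain ⟨t, Z, hZ, hVZ⟩ := exists_isClosed_preimage_π_eq s₁ P hV hVc
  refine ⟨t, Z, hZ, hVZ, inferInstance, inferInstance, baseCone_π_app_apply_eq_genericPoint s₁ t, ?_⟩
  rw [prodCone_π_app]
  exact isPullback_whiskerLeft_left P ((baseCone K L s₁).π.app (op t))

end Spread

end SubalgApprox

end Literature.AlgebraicGeometry.Limits

end
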